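/-
Copyright (c) 2026 the pub-hodgecm-mathlib formalisation cell (harness21).  Prover seat hodgecm-mathlib-F0P3-p01 (g32), Track A «(D-RAM) FOUR-FRAME», unit U2H, census leaf
(ρ2b′-X) — T5b «toric level census, type RamK», organ (M-RK2): the units of the base field `F = M^{⟨ρ,Θ⟩}` are hermitian norms `zΘz` (the `ρ`-averaging argument).  2026-09-04.
-/
import Literature.NumberTheory.LocalFields.WildQuadraticDatumNormFibreValuesAbove   -- ★ p856861: `exists_mul_map_eq_mul_iff` (norm classes multiply), `exists_unit_norm_dichotomy_of_isRamifiedQuadraticDatum` (via import)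
import Literature.NumberTheory.LocalFields.ValuedCompleteIsAdicComplete            -- ★ `isAdicComplete_valuedInteger_of_completeSpace`
import HarnessLib

/-!
# Units fixed by two commuting involutions are norms for either: `𝒪_Fˣ ⊆ N_{M∕K♮}(𝒪_Mˣ)` by `ρ`-averaging
(Serre, *Local Fields* Ch. V §2 Prop. 3 (unramified norms), §3 Cor. 3 (norm index two); Neukirch, *Algebraic Number Theory* Ch. V (1.3)–(1.4) (norm functoriality))

Topic `NumberTheory/LocalFields`; namespace `Literature.NumberTheory.LocalFields.WildQuadraticDatum` (joins ★ `WildQuadraticDatumNormFibres*`, `…UnitNormIndexTwo`).  THEOREMS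
ONLY (no definition, no instance, no notation, no named fact, no `sorry`); kernel lane `--supports stmt-HodgeConjecture-24833` (count-neutral).  Cell `pub/hodgecm-mathlib`
(D-0151), crux H413, Track A, unit U2H, census leaf (ρ2b′-X): organ (M-RK2) of the T5b statement sheet `F0/P3/F0P3-p01/g32/T5bToricLevelCensusRamK.statements.v4`
(hodgecm-mathlib-F0P3-p01 (g32)); payer of record LH4-p14 lineage, plan owner LH4-p12 (g4) (T5-FRAME v1, K♮-currency: «norm groups of K♮∕F, M∕K♮»).

SETTING (one field `K` = model of the biquadratic `M`): two COMMUTING ring endomorphisms `ρ` (fixing `E`) and `Θ` (fixing the third field `K♮`), `Θ` an isometric involution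
whose fixed units satisfy the UNIT NORM DICHOTOMY (`Θ`-fixed units `⊆ N ∪ c₀⁻¹N`, `N = {zΘz}` — ★ `exists_unit_norm_dichotomy_of_isRamifiedQuadraticDatum` for a ramified
quadratic datum `(M, Θ, ϖ, d, t)` over a complete field with finite residue field).  The census (T5b memo §2, type RamK) needs **`𝒪_Fˣ ⊆ N`**: every unit fixed by BOTH `ρ` and
`Θ` is a hermitian norm `zΘz` — the CFT content is norm functoriality `(f, M∕K♮) = (N_{K♮∕F}f, E∕F) = (f², E∕F) = 1`; here it is obtained ELEMENTARILY:
* §1 `exists_mul_map_eq_mul_map_of_theta_fixed` — **`ρ`-AVERAGING**: for every `Θ`-fixed unit `g`, the element `g·ρ(g)` IS a norm `zΘz` (the norm group `N` is `ρ`-stable because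
  `ρ(zΘz) = ρz·Θ(ρz)`, so `g` and `ρg` lie in the SAME `N`-class, and classes multiply — ★ `exists_mul_map_eq_mul_iff`).
* §2 `exists_mul_map_eq_of_fixed_fixed_of_forall_exists` — hence, GIVEN the unramified unit-norm surjectivity of the third field («every `(ρ,Θ)`-fixed unit is `g·ρg` with `g` a
  `Θ`-fixed unit»: Serre V §2 Prop. 3 for `K♮∕F`, supplied by the instantiating seat where `K♮` is a field in its own right — ★ `exists_mul_map_eq_of_finite_residueField`), every
  `(ρ,Θ)`-fixed unit is a norm `zΘz`; `…_of_isRamifiedQuadraticDatum` discharges the dichotomy from ★ under `[CompleteSpace K] [Finite 𝓀[K]]`.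
HONEST LABEL: HC_CM is proved only modulo the 7 printed citations (2 remaining named inputs: hLiu418 = stmt-HodgeConjecture-24832, h413 = stmt-HodgeConjecture-24833) until rung 0
closes; unconditional local algebra, count-neutral (organ (M-RK2) of T5b; (ρ2b′-X) stays an OPEN prover target).

## References
* [Serre1979] J.-P. Serre, *Local Fields*, GTM 67 (1979): Ch. V §2 Prop. 3 (`U_K = N U_L` for an unramified extension), Ch. V §3 Cor. 3 (norm index two for a ramified quadratic
  extension).
* [NeukirchANT1999] J. Neukirch, *Algebraic Number Theory*, Grundlehren 322 (1999): Ch. V (1.3)–(1.4) (the norm residue symbol and its functoriality under base extension).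
-/

set_option autoImplicit false

open WithZero IsLocalRing
open scoped Valued
open Literature.NumberTheory.Automorphic.UnitaryThreeFourFrame

namespace Literature.NumberTheory.LocalFields.WildQuadraticDatum

variable {K : Type} [Field K] [Valued K ℤᵐ⁰] {ρ Θ : K →+* K}

/-! ## §1 `ρ`-averaging: `g·ρ(g)` is a `Θ`-norm for every `Θ`-fixed unit `g` -/

omit [Valued K ℤᵐ⁰] in
/-- The `Θ`-norms are `ρ`-STABLE when `Θρ = ρΘ`: `ρ(z·Θz) = ρz·Θ(ρz)`. [cite: Serre1979, Ch. V §3 Cor. 3] -/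
theorem map_mul_map_eq_of_commute (hΘρ : ∀ x, Θ (ρ x) = ρ (Θ x)) (z : K) : ρ (z * Θ z) = ρ z * Θ (ρ z) := by
  rw [map_mul, hΘρ]

omit [Valued K ℤᵐ⁰] in
/-- A `Θ`-norm class is `ρ`-invariant: `u ∈ N ↔ ρu ∈ N` (`ρρ = id`, `Θρ = ρΘ`). [cite: Serre1979, Ch. V §3 Cor. 3] -/
theorem exists_mul_map_eq_map_iff (hρρ : ∀ x, ρ (ρ x) = x) (hΘρ : ∀ x, Θ (ρ x) = ρ (Θ x)) (u : K) :
    (∃ z : K, z * Θ z = ρ u) ↔ ∃ z : K, z * Θ z = u := by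
  constructor
  · rintro ⟨z, hz⟩
    refine ⟨ρ z, ?_⟩
    rw [← map_mul_map_eq_of_commute hΘρ, hz, hρρ]
  · rintro ⟨z, hz⟩
    exact ⟨ρ z, by rw [← map_mul_map_eq_of_commute hΘρ, hz]⟩

/-- **`ρ`-AVERAGING**: under the unit norm dichotomy for `Θ` (classes multiply, ★ `exists_mul_map_eq_mul_iff`), for every `Θ`-fixed unit `g` the product `g·ρ(g)` is a norm `z·Θz`
— `g` and `ρg` have the same class.  (`ρ` isometric, `Θρ = ρΘ`, `ρρ = id`.) [cite: Serre1979, Ch. V §3 Cor. 3] [cite: NeukirchANT1999, Ch. V (1.3)–(1.4)] -/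
theorem exists_mul_map_eq_mul_map_of_theta_fixed (hρρ : ∀ x, ρ (ρ x) = x) (hvρ : ∀ x, Valued.v (ρ x) = Valued.v x) (hΘρ : ∀ x, Θ (ρ x) = ρ (Θ x))
    {c₀ : K} (hΘc₀ : Θ c₀ = c₀) (hc₀ : Valued.v c₀ = 1)
    (hdich : ∀ u : K, Θ u = u → Valued.v u = 1 → (∃ z : K, z * Θ z = u) ∨ ∃ z : K, z * Θ z = c₀ * u)
    {g : K} (hΘg : Θ g = g) (hg : Valued.v g = 1) : ∃ z : K, z * Θ z = g * ρ g := by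
  have hΘρg : Θ (ρ g) = ρ g := by rw [hΘρ, hΘg]
  have hρg : Valued.v (ρ g) = 1 := by rw [hvρ, hg]
  exact (exists_mul_map_eq_mul_iff hΘc₀ hc₀ hdich hΘg hg hΘρg hρg).2 (exists_mul_map_eq_map_iff hρρ hΘρ g).symm

/-! ## §2 The base units are `Θ`-norms -/

/-- **`𝒪_Fˣ ⊆ N_{M∕K♮}(𝒪_Mˣ)` FROM THE UNRAMIFIED SURJECTIVITY OF THE THIRD FIELD**: if every unit fixed by both `ρ` and `Θ` is `g·ρ(g)` for some `Θ`-fixed unit `g` (Serre V §2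
Prop. 3 for `K♮∕F`), then every such unit is a norm `z·Θz` (§1).  [cite: Serre1979, Ch. V §2 Prop. 3] [cite: NeukirchANT1999, Ch. V (1.3)–(1.4)] -/
theorem exists_mul_map_eq_of_fixed_fixed_of_forall_exists (hρρ : ∀ x, ρ (ρ x) = x) (hvρ : ∀ x, Valued.v (ρ x) = Valued.v x) (hΘρ : ∀ x, Θ (ρ x) = ρ (Θ x))
    {c₀ : K} (hΘc₀ : Θ c₀ = c₀) (hc₀ : Valued.v c₀ = 1)
    (hdich : ∀ u : K, Θ u = u → Valued.v u = 1 → (∃ z : K, z * Θ z = u) ∨ ∃ z : K, z * Θ z = c₀ * u)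
    (hsurj : ∀ f : K, ρ f = f → Θ f = f → Valued.v f = 1 → ∃ g : K, Θ g = g ∧ Valued.v g = 1 ∧ g * ρ g = f)
    {f : K} (hρf : ρ f = f) (hΘf : Θ f = f) (hf : Valued.v f = 1) : ∃ z : K, z * Θ z = f := by
  obtain ⟨g, hΘg, hg, rfl⟩ := hsurj f hρf hΘf hf
  exact exists_mul_map_eq_mul_map_of_theta_fixed hρρ hvρ hΘρ hΘc₀ hc₀ hdich hΘg hg

/-- **The same with the dichotomy DISCHARGED** from ★ `exists_unit_norm_dichotomy_of_isRamifiedQuadraticDatum` for a ramified quadratic datum `(M, Θ, ϖ, d, t)` over a COMPLETE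
field with finite residue field (type RamK of the census: `M∕K♮` is such a datum; the remaining hypothesis is the unramified surjectivity of `K♮∕F`).
[cite: Serre1979, Ch. V §2 Prop. 3] [cite: Serre1979, Ch. V §3 Cor. 3] -/
theorem exists_mul_map_eq_of_fixed_fixed_of_isRamifiedQuadraticDatum [CompleteSpace K] [Finite 𝓀[K]]
    (hρρ : ∀ x, ρ (ρ x) = x) (hvρ : ∀ x, Valued.v (ρ x) = Valued.v x) (hΘρ : ∀ x, Θ (ρ x) = ρ (Θ x))
    {ϖ : K} {d t : ℕ} (hD : IsRamifiedQuadraticDatum Θ ϖ d t)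
    (hsurj : ∀ f : K, ρ f = f → Θ f = f → Valued.v f = 1 → ∃ g : K, Θ g = g ∧ Valued.v g = 1 ∧ g * ρ g = f)
    {f : K} (hρf : ρ f = f) (hΘf : Θ f = f) (hf : Valued.v f = 1) : ∃ z : K, z * Θ z = f := by
  haveI : IsAdicComplete 𝓂[K] 𝒪[K] := isAdicComplete_valuedInteger_of_completeSpace hD.2.2.1
  obtain ⟨c₀, hΘc₀, hc₀, hdich⟩ := exists_unit_norm_dichotomy_of_isRamifiedQuadraticDatum Θ ϖ d t hD
  exact exists_mul_map_eq_of_fixed_fixed_of_forall_exists hρρ hvρ hΘρ hΘc₀ hc₀ hdich hsurj hρf hΘf hf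

end Literature.NumberTheory.LocalFields.WildQuadraticDatum
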